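import Literature.AnabelianGeometry.EtaleTheta.Discharge.Sec5OfThetaSetting
import Literature.AnabelianGeometry.EtaleTheta.Discharge.Sec5EnvAut

/-!
# [EtTh] Theorem 5.10 (iii): «a compatible pair `(Φ, ψ)` stabilises `E^Π_N`» — F-0517 `StabilizesEPiN` has a CLOSED producer at the
# §5 data over the genuine connected base `B^temp(Π^tp_X)⁰` and at the Ÿ̲̲-junction data of a theta setting (p. 335 / PDF p. 109)

S. Mochizuki, *The étale theta function and its Frobenioid-theoretic manifestations*, Publ. RIMS **45** (2009) [EtTh], Theorem 5.10 (iii)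
pp. 334–335 (PDF pp. 108–109) [cite: MochizukiEtTh2009, Thm 5.10 (iii) p.335 (PDF p.109)]; §5 p. 331 (PDF p. 105) («`s^⊓-gp_N`»).

abc-iut cell, layer L2, seat abc-iut-w6-d053 (gen 6); K4 / C-R33 row of the cone node `EtTh:Thm5.10(iii)` (abc-iut-c312-2 CONE-K4-RECLOSE.tsv
v4 row 54: ONE refuted-closure binder, F-0517 `ThetaFrobenioid.StabilizesEPiN Φ ψ`, the hypothesis `h` of abc-iut-L2-d4's API closers
`StabilizesEPiN.symm` / `StabilizesEPiN.map_eq` / `StabilizesEPiN.mem_normalizer` (`Discharge/Sec5EnvAut.lean`); class BLOCKED «no closed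
producer: `IsEnvCompatible.stabilizesEPiN` needs F-0738 `SgpCapSection`» — abc-iut-f-128's K4-L2-INSTANCES sweep).  PROOF-ONLY (0 definitions,
0 instances, 0 new `Prop`; nothing landed is edited or restated).

WHAT IS PROVED.  abc-iut-L2-d4's `IsEnvCompatible.stabilizesEPiN (hc) (hsec)` — "a compatible pair `(Φ, ψ)` [the conditions extracted from
Theorem 5.10 (ii) after composing `Ψ^Aut` with `κ⁻¹`, and the base compatibility of `ψ` with `Ψ^bs`] stabilises
`E^Π_N = E_N ×_{Im(Π^tp_Y̲)} Π^tp_Y̲ ⊆ Aut_C(B_N) × Π^tp_X̲`" (proof of Thm. 5.10 (iii), p. 335) — has the ONE FACT binder `hsec : SgpCapSection`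
(F-0738, «`s^⊓-gp_N` is a section of `Aut_C(B_N) ↠ Aut_D(B_N^bs)`», §5 p. 331), whose universal closure is refuted in the tree
(`MonoThetaToy.not_forall_sgpCapSection`) but which is a THEOREM WITH NO HYPOTHESIS BEYOND THE DATA at abc-iut-L2-t4's §5 data over the
genuine connected base, `sgpCapSection_ofConnectedTemperoidData` (`Discharge/Sec5OfConnectedTemperoid.lean`).  Hence, at
`𝔉 := ThetaFrobenioid.ofConnectedTemperoidData h Q odd_l R ιX K' constEmb constEmb_injective hinvc hinvp` (ANY tempered Frobenioid `tf` over
`B^temp(Π^tp_X)⁰`, any comparison `ιX : T.PiX ≃ₜ* Π^tp_X` with a `ThetaEnvData` `T`, roots `R`, constants `constEmb`):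
* `stabilizesEPiN_ofConnectedTemperoidData` — **F-0517 for EVERY env-compatible pair `(Φ, ψ)`, the only hypothesis being abc-iut-L2-d4's
  VOCABULARY predicate `IsEnvCompatible Φ ψ`** (FACT-LIST F-2489: «predicate/vocabulary, nothing to assume») — a CLOSED producer in
  abc-iut-c312-2's sense (0 assumption-class FACT binders);
* the node's three API closers RE-KEYED on it: `stabilizesEPiN_symm_ofConnectedTemperoidData` (the inverse pair stabilises),
  `map_EPiN_ambientAut_ofConnectedTemperoidData` (`(Φ, ψ)(E^Π_N) = E^Π_N`), `ambientAut_mem_normalizer_ofConnectedTemperoidData`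
  (`(Φ, ψ)` carries `N(E^Π_N)` into itself), and `isEnvCompatible_symm_ofConnectedTemperoidData` (abc-iut-L2-d4's `IsEnvCompatible.symm`
  with its F-0738 binder supplied);
* the same five statements READ AT THE Ÿ̲̲-JUNCTION DATA OF A THETA SETTING, `𝔉 := ofThetaSettingData μ hC hS h Q R K' …` over
  `BiKummerSetting.mkOfThetaSettingYdd C e μ hC hS tf hZ hP NH` (`Π^tp_X̲̲ := C.Huu`, `A_⊙^bs := Ÿ̲̲`; abc-iut-L2-t4's `ofThetaSettingData` IS
  `ofConnectedTemperoidData (T := C.thetaEnvData μ hC hS) … (ContinuousMulEquiv.refl _) …` by `rfl`) — `…_ofThetaSettingYddData`.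
Where the compatible pairs come from is NOT this file's business: abc-iut-L2-t4's route (B) `monoThetaEnvCompat_of_psiAutPreserves` manufactures
them from Theorem 5.10 (ii) AS TYPED (`PsiAutPreserves`, F-0541) and a representative `ψY`; at the Ÿ̲̲-junction data the end forms of record are
abc-iut-L2-t11's `thm510_ii_iii_ofThetaSettingYdd_of_cor218_i(_canonical)` (p462036), modulo {junction data, `hconst`, `hD`, `m`, Thm 5.7 /
Thm 4.4 (iv) AS TYPED, `ψY`, F-0620}.
HONEST FRAMING: kernel re-keying of landed theorems; `tf` is an abstract parameter (no tempered Frobenioid of an actual curve is constructed in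
the tree); FACT rows are assumption LABELS; nothing of [EtTh] is asserted unconditionally; no side is taken on [IUTchIII] Cor. 3.12 or on any
author; typed ≠ proved.
-/

noncomputable section

namespace Literature.AnabelianGeometry.EtaleTheta

open CategoryTheory Opposite Literature.AlgebraicGeometry.Frobenioids Literature.AnabelianGeometry.SemiGraphs
  Literature.AnabelianGeometry.SemiGraphs.GaloisObjects Literature.AlgebraicGeometry.Frobenioids.QuasiTemperoid.BTempConnected
open scoped Pointwise

universe u₀ v₀ w

namespace ThetaFrobenioid

/-! ## §1. Over the genuine connected base `B^temp(Π^tp_X)⁰` (any `ConnectedTemperoidData` junction) -/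

section Connected

variable {K : Type u₀} [Field K] {X : SemiGraphs.TemperedArithmeticGroup.{u₀} K} {D₀ : Type u₀} [Category.{v₀} D₀]
  {V : FrdIMonoidStub.{w}} {T₀ : RealifiedDivisorMonoids (D₀ := D₀) V}
  {VD : FrdICatStub.{u₀ + 1, u₀, w} (ConnectedPart (BTemp X.Pi))}
  {tf : TemperedFrobenioid T₀ (ConnectedPart (BTemp X.Pi)) VD} {hZ : tf.monoidType = MonoidType.Z}
  {hP : ∀ A : (ConnectedPart (BTemp X.Pi))ᵒᵖ, IsPerfect (tf.Φ.carrier A)}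
  {NH : Subgroup (Field.absoluteGaloisGroup K) → tf.category → ℕ+ → Prop} {A₀ : tf.category}
  {hA₀ : PreFrobenioid.IsFrobeniusTrivial tf.toElem A₀} {hA₀' : SemiGraphs.IsGaloisObj A₀.base.obj}
  {pullFrac : ∀ {A A' : (BiKummerSetting.mkOfConnectedTemperoid X tf hZ hP NH A₀ hA₀ hA₀').C} (_ : A' ⟶ A),
    (BiKummerSetting.mkOfConnectedTemperoid X tf hZ hP NH A₀ hA₀ hA₀').biratUnits A →
      (BiKummerSetting.mkOfConnectedTemperoid X tf hZ hP NH A₀ hA₀ hA₀').biratUnits A'}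
  {lv N : ℕ+} {T : ThetaEnvData.{max u₀ w} N}
  {θ : (BiKummerSetting.mkOfConnectedTemperoid X tf hZ hP NH A₀ hA₀ hA₀').biratUnits
    (BiKummerSetting.mkOfConnectedTemperoid X tf hZ hP NH A₀ hA₀ hA₀').Aodot}
  {Bl : (BiKummerSetting.mkOfConnectedTemperoid X tf hZ hP NH A₀ hA₀ hA₀').C}
  {Pl : (BiKummerSetting.mkOfConnectedTemperoid X tf hZ hP NH A₀ hA₀ hA₀').FractionPair θ Bl}
  {Rl : (BiKummerSetting.mkOfConnectedTemperoid X tf hZ hP NH A₀ hA₀ hA₀').NthRoot θ Pl lv pullFrac}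
  (h : ModelFrobenioid.Hypotheses tf.divisorMonoid tf.ratFnFunctor)
  (Q : FrobenioidTheta.ThetaSubquotientStub.{w} (ConnectedPart (BTemp X.Pi))) (odd_l : Odd (lv : ℕ))
  (R : (BiKummerSetting.mkOfConnectedTemperoid X tf hZ hP NH A₀ hA₀ hA₀').NthRoot Rl.root Rl.pair N pullFrac)
  (ιX : T.PiX ≃ₜ* X.Pi) (K' : Type w) [Field K'] (constEmb : K'ˣ →* tf.biratUnitsModel R.BN)
  (constEmb_injective : Function.Injective constEmb)
  (hinvc : ∀ g : Aut R.AN.base,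
    pull tf.divisorMonoid g.hom (ModelFrobenioid.div R.pair.num) = ModelFrobenioid.div R.pair.num)
  (hinvp : ∀ y : T.PiX, y ∈ T.PiYdd →
    pull tf.divisorMonoid ((BiKummerSetting.mkOfConnectedTemperoid X tf hZ hP NH A₀ hA₀ hA₀').galoisSurj R.AN.base
      R.αData.isGalois (ιX y)).hom (ModelFrobenioid.div R.pair.den) = ModelFrobenioid.div R.pair.den)
  {Φ : Aut (ofConnectedTemperoidData h Q odd_l R ιX K' constEmb constEmb_injective hinvc hinvp).BN ≃*
    Aut (ofConnectedTemperoidData h Q odd_l R ιX K' constEmb constEmb_injective hinvc hinvp).BN}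
  {ψ : (ofConnectedTemperoidData h Q odd_l R ιX K' constEmb constEmb_injective hinvc hinvp).PiX ≃ₜ*
    (ofConnectedTemperoidData h Q odd_l R ιX K' constEmb constEmb_injective hinvc hinvp).PiX}
  (hc : (ofConnectedTemperoidData h Q odd_l R ιX K' constEmb constEmb_injective hinvc hinvp).IsEnvCompatible Φ ψ)

include hc

/-- **F-0517 `StabilizesEPiN` — CLOSED producer over the genuine connected base**: for the §5 data `ofConnectedTemperoidData …` over
`B^temp(Π^tp_X)⁰`, EVERY env-compatible pair `(Φ, ψ)` (abc-iut-L2-d4's vocabulary predicate `IsEnvCompatible`, the conditions of Thm. 5.10 (ii) /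
Thm. 4.4 (i)) stabilises `E^Π_N` — abc-iut-L2-d4's `IsEnvCompatible.stabilizesEPiN` with its F-0738 binder `hsec` SUPPLIED by abc-iut-L2-t4's
`sgpCapSection_ofConnectedTemperoidData` (no hypothesis beyond the data).  [cite: MochizukiEtTh2009, Thm 5.10 (iii) p.335 (PDF p.109)] -/
theorem stabilizesEPiN_ofConnectedTemperoidData :
    (ofConnectedTemperoidData h Q odd_l R ιX K' constEmb constEmb_injective hinvc hinvp).StabilizesEPiN Φ ψ :=
  hc.stabilizesEPiN (sgpCapSection_ofConnectedTemperoidData h Q odd_l R ιX K' constEmb constEmb_injective hinvc hinvp)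

/-- **The inverse pair is again env-compatible** (abc-iut-L2-d4's `IsEnvCompatible.symm`, F-0738 binder supplied).
[cite: MochizukiEtTh2009, Thm 5.10 (iii) p.335 (PDF p.109)] -/
theorem isEnvCompatible_symm_ofConnectedTemperoidData :
    (ofConnectedTemperoidData h Q odd_l R ιX K' constEmb constEmb_injective hinvc hinvp).IsEnvCompatible Φ.symm ψ.symm :=
  hc.symm (sgpCapSection_ofConnectedTemperoidData h Q odd_l R ιX K' constEmb constEmb_injective hinvc hinvp)

/-- **The node's closer `StabilizesEPiN.symm` RE-KEYED**: the inverse pair `(Φ⁻¹, ψ⁻¹)` stabilises `E^Π_N`, for every env-compatible pair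
over the genuine connected base.  [cite: MochizukiEtTh2009, Thm 5.10 (iii) p.335 (PDF p.109)] -/
theorem stabilizesEPiN_symm_ofConnectedTemperoidData :
    (ofConnectedTemperoidData h Q odd_l R ιX K' constEmb constEmb_injective hinvc hinvp).StabilizesEPiN Φ.symm ψ.symm :=
  (stabilizesEPiN_ofConnectedTemperoidData h Q odd_l R ιX K' constEmb constEmb_injective hinvc hinvp hc).symm

/-- **The node's closer `StabilizesEPiN.map_eq` RE-KEYED**: `(Φ, ψ)(E^Π_N) = E^Π_N` ("`γ` … an automorphism of the topological group
`E^Π_N`", p. 335), for every env-compatible pair over the genuine connected base.  [cite: MochizukiEtTh2009, Thm 5.10 (iii) p.335 (PDF p.109)] -/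
theorem map_EPiN_ambientAut_ofConnectedTemperoidData :
    (ofConnectedTemperoidData h Q odd_l R ιX K' constEmb constEmb_injective hinvc hinvp).EPiN.map
        ((ofConnectedTemperoidData h Q odd_l R ιX K' constEmb constEmb_injective hinvc hinvp).ambientAut Φ ψ).toMonoidHom =
      (ofConnectedTemperoidData h Q odd_l R ιX K' constEmb constEmb_injective hinvc hinvp).EPiN :=
  (stabilizesEPiN_ofConnectedTemperoidData h Q odd_l R ιX K' constEmb constEmb_injective hinvc hinvp hc).map_eq

/-- **The node's closer `StabilizesEPiN.mem_normalizer` RE-KEYED**: `(Φ, ψ)` carries the normaliser `N(E^Π_N) ⊆ Aut_C(B_N) × Π^tp_X̲` into itself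
(the bookkeeping behind "`γ` determines an automorphism of mono-theta environments": `Out(E^Π_N)` is transported), for every env-compatible pair
over the genuine connected base.  [cite: MochizukiEtTh2009, Thm 5.10 (iii) p.335 (PDF p.109)] -/
theorem ambientAut_mem_normalizer_ofConnectedTemperoidData
    {n : Aut (ofConnectedTemperoidData h Q odd_l R ιX K' constEmb constEmb_injective hinvc hinvp).BN ×
      (ofConnectedTemperoidData h Q odd_l R ιX K' constEmb constEmb_injective hinvc hinvp).PiX}
    (hn : n ∈ Subgroup.normalizer
      ((ofConnectedTemperoidData h Q odd_l R ιX K' constEmb constEmb_injective hinvc hinvp).EPiN :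
        Set (Aut (ofConnectedTemperoidData h Q odd_l R ιX K' constEmb constEmb_injective hinvc hinvp).BN ×
          (ofConnectedTemperoidData h Q odd_l R ιX K' constEmb constEmb_injective hinvc hinvp).PiX))) :
    (ofConnectedTemperoidData h Q odd_l R ιX K' constEmb constEmb_injective hinvc hinvp).ambientAut Φ ψ n ∈
      Subgroup.normalizer
        ((ofConnectedTemperoidData h Q odd_l R ιX K' constEmb constEmb_injective hinvc hinvp).EPiN :
          Set (Aut (ofConnectedTemperoidData h Q odd_l R ιX K' constEmb constEmb_injective hinvc hinvp).BN ×
            (ofConnectedTemperoidData h Q odd_l R ιX K' constEmb constEmb_injective hinvc hinvp).PiX)) :=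
  (stabilizesEPiN_ofConnectedTemperoidData h Q odd_l R ιX K' constEmb constEmb_injective hinvc hinvp hc).mem_normalizer hn

end Connected

/-! ## §2. Read at the Ÿ̲̲-junction data of a theta setting (`Π^tp_X̲̲ := C.Huu`, `A_⊙^bs := Ÿ̲̲`) -/

section Setting

variable {p : ℕ} [Fact p.Prime] {D : ThetaSetting p} {E : D.EtaleThetaData} {l : ℕ} {C : E.DoubleUnderline l}
  {e : D.toTemperedCurve.GroupLevelData} {N : ℕ+} (μ : D.CyclotomeMod l N) (hC : D.Compat) (hS : D.Sec2Hyps)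
  {D₀ : Type} [Category.{v₀} D₀] {V : FrdIMonoidStub.{0}} {T₀ : RealifiedDivisorMonoids (D₀ := D₀) V}
  {VD : FrdICatStub.{1, 0, 0} (ConnectedPart (BTemp (C.temperedArithmeticGroup e).Pi))}
  {tf : TemperedFrobenioid T₀ (ConnectedPart (BTemp (C.temperedArithmeticGroup e).Pi)) VD} {hZ : tf.monoidType = MonoidType.Z}
  {hP : ∀ A : (ConnectedPart (BTemp (C.temperedArithmeticGroup e).Pi))ᵒᵖ, IsPerfect (tf.Φ.carrier A)}
  {NH : Subgroup (Field.absoluteGaloisGroup D.K) → tf.category → ℕ+ → Prop}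
  {pullFrac : ∀ {A A' : (BiKummerSetting.mkOfThetaSettingYdd C e μ hC hS tf hZ hP NH).C} (_ : A' ⟶ A),
    (BiKummerSetting.mkOfThetaSettingYdd C e μ hC hS tf hZ hP NH).biratUnits A →
      (BiKummerSetting.mkOfThetaSettingYdd C e μ hC hS tf hZ hP NH).biratUnits A'}
  {θ : (BiKummerSetting.mkOfThetaSettingYdd C e μ hC hS tf hZ hP NH).biratUnits (BiKummerSetting.mkOfThetaSettingYdd C e μ hC hS tf hZ hP NH).Aodot}
  {Bl : (BiKummerSetting.mkOfThetaSettingYdd C e μ hC hS tf hZ hP NH).C}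
  {Pl : (BiKummerSetting.mkOfThetaSettingYdd C e μ hC hS tf hZ hP NH).FractionPair θ Bl}
  {Rl : (BiKummerSetting.mkOfThetaSettingYdd C e μ hC hS tf hZ hP NH).NthRoot θ Pl C.lPNat pullFrac}
  (h : ModelFrobenioid.Hypotheses tf.divisorMonoid tf.ratFnFunctor)
  (Q : FrobenioidTheta.ThetaSubquotientStub.{0} (ConnectedPart (BTemp (C.temperedArithmeticGroup e).Pi)))
  (R : (BiKummerSetting.mkOfThetaSettingYdd C e μ hC hS tf hZ hP NH).NthRoot Rl.root Rl.pair N pullFrac)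
  (K' : Type) [Field K'] (constEmb : K'ˣ →* tf.biratUnitsModel R.BN) (constEmb_injective : Function.Injective constEmb)
  (hinvc : ∀ g : Aut R.AN.base,
    pull tf.divisorMonoid g.hom (ModelFrobenioid.div R.pair.num) = ModelFrobenioid.div R.pair.num)
  (hinvp : ∀ y : (C.thetaEnvData μ hC hS).PiX, y ∈ (C.thetaEnvData μ hC hS).PiYdd →
    pull tf.divisorMonoid ((BiKummerSetting.mkOfThetaSettingYdd C e μ hC hS tf hZ hP NH).galoisSurj
      R.AN.base R.αData.isGalois ((ContinuousMulEquiv.refl _) y)).hom (ModelFrobenioid.div R.pair.den) = ModelFrobenioid.div R.pair.den)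
  {Φ : Aut (ofThetaSettingData μ hC hS h Q R K' constEmb constEmb_injective hinvc hinvp).BN ≃*
    Aut (ofThetaSettingData μ hC hS h Q R K' constEmb constEmb_injective hinvc hinvp).BN}
  {ψ : (ofThetaSettingData μ hC hS h Q R K' constEmb constEmb_injective hinvc hinvp).PiX ≃ₜ*
    (ofThetaSettingData μ hC hS h Q R K' constEmb constEmb_injective hinvc hinvp).PiX}
  (hc : (ofThetaSettingData μ hC hS h Q R K' constEmb constEmb_injective hinvc hinvp).IsEnvCompatible Φ ψ)

include hc

/-- **F-0517 `StabilizesEPiN` at the Ÿ̲̲-junction data of a theta setting**, for EVERY env-compatible pair `(Φ, ψ)` — the only hypothesis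
the vocabulary predicate `IsEnvCompatible Φ ψ` (F-0738 supplied by abc-iut-L2-t4's `sgpCapSection_ofConnectedTemperoidData`, read at the
Setting as in this base's gen-5 `sgpCapSection_ofThetaSettingYddData`).  [cite: MochizukiEtTh2009, Thm 5.10 (iii) p.335 (PDF p.109)] -/
theorem stabilizesEPiN_ofThetaSettingYddData :
    (ofThetaSettingData μ hC hS h Q R K' constEmb constEmb_injective hinvc hinvp).StabilizesEPiN Φ ψ :=
  hc.stabilizesEPiN (sgpCapSection_ofConnectedTemperoidData (T := C.thetaEnvData μ hC hS) h Q C.odd_lPNat R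
    (ContinuousMulEquiv.refl _) K' constEmb constEmb_injective hinvc hinvp)

/-- The inverse pair is again env-compatible, at the Ÿ̲̲-junction data.  [cite: MochizukiEtTh2009, Thm 5.10 (iii) p.335 (PDF p.109)] -/
theorem isEnvCompatible_symm_ofThetaSettingYddData :
    (ofThetaSettingData μ hC hS h Q R K' constEmb constEmb_injective hinvc hinvp).IsEnvCompatible Φ.symm ψ.symm :=
  hc.symm (sgpCapSection_ofConnectedTemperoidData (T := C.thetaEnvData μ hC hS) h Q C.odd_lPNat R
    (ContinuousMulEquiv.refl _) K' constEmb constEmb_injective hinvc hinvp)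

/-- The node's closer `StabilizesEPiN.symm` RE-KEYED at the Ÿ̲̲-junction data.  [cite: MochizukiEtTh2009, Thm 5.10 (iii) p.335 (PDF p.109)] -/
theorem stabilizesEPiN_symm_ofThetaSettingYddData :
    (ofThetaSettingData μ hC hS h Q R K' constEmb constEmb_injective hinvc hinvp).StabilizesEPiN Φ.symm ψ.symm :=
  (stabilizesEPiN_ofThetaSettingYddData μ hC hS h Q R K' constEmb constEmb_injective hinvc hinvp hc).symm

/-- The node's closer `StabilizesEPiN.map_eq` RE-KEYED at the Ÿ̲̲-junction data: `(Φ, ψ)(E^Π_N) = E^Π_N`.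
[cite: MochizukiEtTh2009, Thm 5.10 (iii) p.335 (PDF p.109)] -/
theorem map_EPiN_ambientAut_ofThetaSettingYddData :
    (ofThetaSettingData μ hC hS h Q R K' constEmb constEmb_injective hinvc hinvp).EPiN.map
        ((ofThetaSettingData μ hC hS h Q R K' constEmb constEmb_injective hinvc hinvp).ambientAut Φ ψ).toMonoidHom =
      (ofThetaSettingData μ hC hS h Q R K' constEmb constEmb_injective hinvc hinvp).EPiN :=
  (stabilizesEPiN_ofThetaSettingYddData μ hC hS h Q R K' constEmb constEmb_injective hinvc hinvp hc).map_eq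

/-- The node's closer `StabilizesEPiN.mem_normalizer` RE-KEYED at the Ÿ̲̲-junction data: `(Φ, ψ)` carries `N(E^Π_N)` into itself.
[cite: MochizukiEtTh2009, Thm 5.10 (iii) p.335 (PDF p.109)] -/
theorem ambientAut_mem_normalizer_ofThetaSettingYddData
    {n : Aut (ofThetaSettingData μ hC hS h Q R K' constEmb constEmb_injective hinvc hinvp).BN ×
      (ofThetaSettingData μ hC hS h Q R K' constEmb constEmb_injective hinvc hinvp).PiX}
    (hn : n ∈ Subgroup.normalizer
      ((ofThetaSettingData μ hC hS h Q R K' constEmb constEmb_injective hinvc hinvp).EPiN :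
        Set (Aut (ofThetaSettingData μ hC hS h Q R K' constEmb constEmb_injective hinvc hinvp).BN ×
          (ofThetaSettingData μ hC hS h Q R K' constEmb constEmb_injective hinvc hinvp).PiX))) :
    (ofThetaSettingData μ hC hS h Q R K' constEmb constEmb_injective hinvc hinvp).ambientAut Φ ψ n ∈
      Subgroup.normalizer
        ((ofThetaSettingData μ hC hS h Q R K' constEmb constEmb_injective hinvc hinvp).EPiN :
          Set (Aut (ofThetaSettingData μ hC hS h Q R K' constEmb constEmb_injective hinvc hinvp).BN ×
            (ofThetaSettingData μ hC hS h Q R K' constEmb constEmb_injective hinvc hinvp).PiX)) :=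
  (stabilizesEPiN_ofThetaSettingYddData μ hC hS h Q R K' constEmb constEmb_injective hinvc hinvp hc).mem_normalizer hn

end Setting

end ThetaFrobenioid

end Literature.AnabelianGeometry.EtaleTheta

end
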